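import Summits.ResolutionOfSingularities.ResolutionOfSingularities.Theorems.PlanarCutStates
import HarnessLib

/-!
# PlanarCutRows — decomp-res node «PlanarCut» (lens-5 g18 rev 1), tree file 2/5: the LOWEST ROW of a layer after
a planar move is a
univariate TAYLOR SHIFT (PROVED) — the engine behind the two inequalities of the strict multiplicity.

Content VERBATIM from the decomp-res lens-5 g18 file `HOME/decomp-res-lens-5/g18/parts/PlanarCut-REV1-155d4ffb.lean`
(sha256 155d4ffbaf2b8fc3; the REV1
pin the critic graded, CRITIC-LEDGER rows 119 + 119a CLEARED: DECIDED +1 · MAP +1; supersedes the NODE pin b3c721b9).  HOME =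
run/shared/lean/pub/decomp-res.  Host: route `MaxContactCut`, aside 31770 `MaxContactCut.DefectWalksDeep` BY NAME
through the tree's
`ExitLaw.defectWalksDeep_iff_joint'` (`Theorems/MaxContactCutExitLaw`).

[WRITER NOTE (decomp-res writer g6): the lens file is split into `PlanarCutStates` (§1–§4 state level) →
`PlanarCutRows` (the Taylor row of a
layer) → `PlanarCutMoves` (strict-multiplicity inequalities, dead layers) → `PlanarCutWalks` (§5 walk level:
potential, descent, kill) →
`MaxContactCutPlanarCut` (§6/§6b classes + `closes` BY NAME); `set_option` lines dropped; §7 adapters (VERBATIM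
restatements of lens-5 g17
`TransportCut` / lens-3 g15 `ConeCut` classes) are NOT landed here — they follow once `Theorems/TransportCut*` /
`ConeCut*` are in the tree
(critic row 119: import, do not duplicate).  All files sit inside the Theses cone (the exit-law walk model
`ExitLawStates` imports the
route's itinerary model), so the §6 classes are booked as TREE THEOREMS / docstrings, not as route asides.]
(Sources: Hauser2010 §§D–G; HauserPerlega2019; CossartJannsenSaito2020 Thm. 2.14; CossartPiltant2019; Moh1987.)
-/

noncomputable section

open MvPolynomial Finset
open Literature.AlgebraicGeometry.Resolution
open Literature.AlgebraicGeometry.Resolution.Hauser2010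
open Literature.AlgebraicGeometry.Resolution.PointBlowup
open Literature.AlgebraicGeometry.Resolution.WeightedBlowup
open Summit.ResolutionOfSingularities.ResolutionOfSingularities.Theses
open Summit.ResolutionOfSingularities.ResolutionOfSingularities.Theorems.TightDefectClasses
open Summit.ResolutionOfSingularities.ResolutionOfSingularities.Theorems.TightDefectStrongWalks
open Summit.ResolutionOfSingularities.ResolutionOfSingularities.Theorems.ItineraryCutClasses
open Summit.ResolutionOfSingularities.ResolutionOfSingularities.Theorems.BoundaryLedger
open Summit.ResolutionOfSingularities.ResolutionOfSingularities.Theorems.ProximityCut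
open Summit.ResolutionOfSingularities.ResolutionOfSingularities.Theorems.ExitLaw

namespace Summit.ResolutionOfSingularities.ResolutionOfSingularities.Theorems.PlanarCut

section Planar

variable {K : Type} [Field K] [DecidableEq K]

variable {i j k : Fin 3} (hij : i ≠ j) (hjk : j ≠ k) (hik : i ≠ k)
include hij hjk hik

/-! ### The lowest row of a layer after a planar move: a univariate Taylor shift -/

/-- The ROW POLYNOMIAL of layer `a` of `F` at `u_i u_j`-degree `n`, dehomogenised (`u_j := 1`) and Taylor-shifted by
`β`: `Σ_{d_k = a, d_i + d_j = n} coeff_d F · (X + β)^{d_i}`.  DEFINITION (support). -/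
noncomputable def rowPoly (i j k : Fin 3) (a n : ℕ) (β : K) (F : MvPolynomial (Fin 3) K) : Polynomial K :=
  ∑ d ∈ (layer k a F).filter (fun d => d i + d j = n),
    Polynomial.C (coeff d F) * (Polynomial.X + Polynomial.C β) ^ (d i)

omit hij hjk hik [DecidableEq K] in
/-- The row polynomial is the Taylor shift of the dehomogenised row. [folklore] -/
theorem rowPoly_eq_taylor (a n : ℕ) (β : K) (F : MvPolynomial (Fin 3) K) :
    rowPoly i j k a n β F = Polynomial.taylor β
      (∑ d ∈ (layer k a F).filter (fun d => d i + d j = n), Polynomial.monomial (d i) (coeff d F)) := by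
  unfold rowPoly
  rw [map_sum]
  exact Finset.sum_congr rfl fun d _ => (Polynomial.taylor_monomial _ _ _).symm

omit [DecidableEq K] in
/-- In a row, an exponent is determined by its `u_i`-exponent. [folklore] -/
theorem eq_of_row {a n : ℕ} {F : MvPolynomial (Fin 3) K} {d d' : Fin 3 →₀ ℕ}
    (hd : d ∈ (layer k a F).filter (fun d => d i + d j = n))
    (hd' : d' ∈ (layer k a F).filter (fun d => d i + d j = n)) (h : d i = d' i) : d = d' := by
  rw [Finset.mem_filter, mem_layer] at hd hd'
  exact finsupp_ext_three hij hjk hik h (by omega) (by rw [hd.1.2, hd'.1.2])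

omit [DecidableEq K] in
/-- A non-empty row has a non-zero row polynomial. [folklore] -/
theorem rowPoly_ne_zero {a n : ℕ} (β : K) {F : MvPolynomial (Fin 3) K}
    (hne : ((layer k a F).filter (fun d => d i + d j = n)).Nonempty) : rowPoly i j k a n β F ≠ 0 := by
  classical
  obtain ⟨d₁, hd₁⟩ := hne
  rw [rowPoly_eq_taylor]
  intro h
  have h0 : (∑ d ∈ (layer k a F).filter (fun d => d i + d j = n), Polynomial.monomial (d i) (coeff d F)) = 0 :=
    Polynomial.taylor_injective β (by rw [map_zero]; exact h)
  have hc := congrArg (fun P : Polynomial K => P.coeff (d₁ i)) h0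
  simp only [Polynomial.finsetSum_coeff, Polynomial.coeff_monomial, Polynomial.coeff_zero] at hc
  rw [Finset.sum_eq_single d₁] at hc
  · rw [if_pos rfl] at hc
    exact ((mem_layer.mp (Finset.mem_filter.mp hd₁).1).1) hc
  · intro d hd hne'
    rw [if_neg]
    intro h'
    exact hne' (eq_of_row hij hjk hik hd hd₁ h')
  · intro h'
    exact absurd hd₁ h'

omit hij hjk hik [DecidableEq K] in
/-- Coefficients of the row polynomial. [folklore] -/
theorem coeff_rowPoly (a n : ℕ) (β : K) (F : MvPolynomial (Fin 3) K) (l : ℕ) :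
    (rowPoly i j k a n β F).coeff l =
      ∑ d ∈ (layer k a F).filter (fun d => d i + d j = n),
        coeff d F * ((((d i).choose l : ℕ) : K) * β ^ (d i - l)) := by
  unfold rowPoly
  rw [Polynomial.finsetSum_coeff]
  refine Finset.sum_congr rfl fun d _ => ?_
  rw [Polynomial.coeff_C_mul, Polynomial.coeff_X_add_C_pow]
  ring

/-- **THE LOWEST ROW AFTER A PLANAR MOVE IS THE ROW POLYNOMIAL (PROVED).**  With `n₀` the least `u_i u_j`-degree of
layer `a` (`1 ≤ a < q`) and `Y = n₀ + a − q`, the coefficient of `u_i^l u_j^Y u_k^a` in the new state is the `l`-th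
coefficient of the row polynomial of the lowest row, Taylor-shifted by `b_i`. [new] [folklore] -/
theorem coeff_step_lowest_row (q : ℕ) (b : Fin 3 → K) (hbj : b j = 0) (hbk : b k = 0) (s : State (Fin 3) K)
    (hF : ∀ d ∈ s.F.support, q ≤ d.degree) {a : ℕ} (ha1 : 1 ≤ a) (haq : a < q) {n₀ : ℕ} (hn₀ : q ≤ n₀ + a)
    (l : ℕ) :
    coeff (exp3 i j k l (n₀ + a - q) a) (step q j b s).F = (rowPoly i j k a n₀ (b i) s.F).coeff l := by
  classical
  rw [coeff_step_of_layer q j b s ha1 haq (exp3_k hjk hik _ _ _),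
    coeff_pointTransform_planar hij hjk hik q b hbj hbk s.F hF, coeff_rowPoly,
    exp3_i hij hik, exp3_j hij hjk, exp3_k hjk hik]
  unfold layer
  rw [Finset.filter_filter]
  refine Finset.sum_congr ?_ fun d _ => rfl
  refine Finset.filter_congr fun d hd => ?_
  have := degree_three hij hjk hik d
  constructor
  · rintro ⟨h1, h2⟩
    exact ⟨h1, by omega⟩
  · rintro ⟨h1, h2⟩
    exact ⟨h1, by omega⟩

/-- **KEY LEMMA (PROVED): the lowest new row carries a monomial of small `u_i`-exponent.**  Layer `a` non-empty,
`n₀ / x₀ / y₀` its least `u_i u_j`-degree / `u_i`- / `u_j`-exponent: the new layer has an exponent `d*` on the row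
`Y = n₀ + a − q` with `d*_i ≤ (n₀ − x₀ − y₀) + (least u_i-exponent of the new layer)`.
Untranslated: the row is copied;
translated (`b_i ≠ 0`): the row polynomial is `(X + b_i)^{x₀}` times a polynomial of degree `≤ n₀ − x₀
− y₀`, whose
trailing degree is therefore at most that. [new] [folklore] -/
theorem exists_low_exponent (q : ℕ) (b : Fin 3 → K) (hbj : b j = 0) (hbk : b k = 0) (s : State (Fin 3) K)
    (hF : ∀ d ∈ s.F.support, q ≤ d.degree) {a : ℕ} (ha1 : 1 ≤ a) (haq : a < q)
    (hne : (layer k a s.F).Nonempty) :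
    ∃ dstar ∈ layer k a (step q j b s).F,
      dstar j + q = loSum (layer k a s.F) i j + a ∧
      dstar i ≤ sm (layer k a s.F) i j + lo (layer k a (step q j b s).F) i := by
  classical
  set S := layer k a s.F with hS
  set n₀ := loSum S i j with hn₀def
  set x₀ := lo S i with hx₀def
  set y₀ := lo S j with hy₀def
  obtain ⟨d₁, hd₁S, hd₁⟩ := exists_loSum_eq hne i j
  have hd₁F : d₁ ∈ s.F.support := (Finset.mem_filter.mp hd₁S).1
  have hd₁k : d₁ k = a := (Finset.mem_filter.mp hd₁S).2
  have hn₀ : q ≤ n₀ + a := by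
    have h1 := hF d₁ hd₁F
    have h2 := degree_three hij hjk hik d₁
    omega
  have hxy : x₀ + y₀ ≤ n₀ := lo_add_lo_le_loSum i j
  have hrow : d₁ ∈ S.filter (fun d => d i + d j = n₀) := Finset.mem_filter.mpr ⟨hd₁S, hd₁⟩
  set Q := rowPoly i j k a n₀ (b i) s.F with hQ
  have hQ0 : Q ≠ 0 := rowPoly_ne_zero hij hjk hik (b i) ⟨d₁, hrow⟩
  set lstar := Q.natTrailingDegree with hl
  have hcoef : Q.coeff lstar ≠ 0 := mt Polynomial.coeff_natTrailingDegree_eq_zero.mp hQ0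
  have hmem : exp3 i j k lstar (n₀ + a - q) a ∈ layer k a (step q j b s).F := by
    rw [mem_layer, coeff_step_lowest_row hij hjk hik q b hbj hbk s hF ha1 haq hn₀, exp3_k hjk hik]
    exact ⟨hcoef, rfl⟩
  refine ⟨_, hmem, ?_, ?_⟩
  · rw [exp3_j hij hjk]
    omega
  · rw [exp3_i hij hik]
    show lstar ≤ sm S i j + lo (layer k a (step q j b s).F) i
    have hsm : sm S i j = n₀ - x₀ - y₀ := rfl
    by_cases hbi : b i = 0
    · -- untranslated: the row is copied; `lstar ≤ d₁ i ≤ n₀ − y₀ = sm + x₀ ≤ sm + lo⁺ i`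
      have h1 : lstar ≤ d₁ i := by
        apply Polynomial.natTrailingDegree_le_of_ne_zero
        rw [hQ, coeff_rowPoly, Finset.sum_eq_single d₁]
        · rw [hbi, choose_mul_zero_pow, if_pos rfl, mul_one]
          exact MvPolynomial.mem_support_iff.mp hd₁F
        · intro d hd hne'
          rw [hbi, choose_mul_zero_pow, if_neg, mul_zero]
          intro h'
          exact hne' (eq_of_row hij hjk hik hd hrow h')
        · intro h'
          exact absurd hrow h'
      have h2 : y₀ ≤ d₁ j := lo_le hd₁S j
      have h3 : x₀ ≤ lo (layer k a (step q j b s).F) i := by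
        apply le_lo ⟨_, hmem⟩
        intro d' hd'
        obtain ⟨d, hd, -, -, h4⟩ := origin_of_mem_layer_step hij hjk hik q b hbj hbk s hF hd'
        rw [h4 hbi]
        exact lo_le hd i
      omega
    · -- translated: `Q = (X + β)^{x₀} · Q̃`, `deg Q̃ ≤ n₀ − x₀ − y₀`
      set R := S.filter (fun d => d i + d j = n₀) with hR
      set L : Polynomial K := Polynomial.X + Polynomial.C (b i) with hL
      set Qt : Polynomial K := ∑ d ∈ R, Polynomial.C (coeff d s.F) * L ^ (d i - x₀) with hQt
      have hfac : Q = L ^ x₀ * Qt := by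
        rw [hQ, hQt, Finset.mul_sum]
        unfold rowPoly
        refine Finset.sum_congr rfl fun d hd => ?_
        have hx : x₀ ≤ d i := lo_le (Finset.mem_filter.mp hd).1 i
        obtain ⟨m, hm⟩ := Nat.exists_eq_add_of_le hx
        rw [← hL, hm, Nat.add_sub_cancel_left, pow_add]
        ring
      have hL0 : L ^ x₀ ≠ 0 := pow_ne_zero _ (Polynomial.X_add_C_ne_zero (b i))
      have hQt0 : Qt ≠ 0 := by
        intro h
        rw [h, mul_zero] at hfac
        exact hQ0 hfac
      have htr : lstar = (L ^ x₀).natTrailingDegree + Qt.natTrailingDegree := by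
        rw [hl, hfac, Polynomial.natTrailingDegree_mul hL0 hQt0]
      have hL1 : (L ^ x₀).natTrailingDegree = 0 := by
        apply Polynomial.natTrailingDegree_eq_zero.mpr
        right
        rw [hL, Polynomial.coeff_X_add_C_pow]
        simp [hbi]
      have hdeg : Qt.natDegree ≤ n₀ - x₀ - y₀ := by
        rw [hQt]
        apply Polynomial.natDegree_sum_le_of_forall_le
        intro d hd
        have hy : y₀ ≤ d j := lo_le (Finset.mem_filter.mp hd).1 j
        have hs : d i + d j = n₀ := (Finset.mem_filter.mp hd).2
        calc (Polynomial.C (coeff d s.F) * L ^ (d i - x₀)).natDegree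
            ≤ (L ^ (d i - x₀)).natDegree := Polynomial.natDegree_C_mul_le _ _
          _ ≤ (d i - x₀) * L.natDegree := Polynomial.natDegree_pow_le
          _ ≤ n₀ - x₀ - y₀ := by rw [hL, Polynomial.natDegree_X_add_C]; omega
      have := Polynomial.natTrailingDegree_le_natDegree Qt
      omega

end Planar

end Summit.ResolutionOfSingularities.ResolutionOfSingularities.Theorems.PlanarCut
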